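import Summits.CriticalPhenomena.PercolationContinuityZ3.Theorems.PercNearOneGluingNoHeavyQuantGatedSliceMixLawCells
import HarnessLib

/-!
# QUANT lane R8, T-DEC, leg (III), blob case — `LawDec.MixLawCellA5` (the unsaturated-mid mixture cell of `GatedSliceMixLaw'`) DECOMPOSED:
# the ONE residual sub-cell left after the lead's kernel sub-cells (i) `…A5Fit`, (ii) `…A5Mix`, (ii′) `…A5Fill`, (iii) `…A5Incomp` and
# `k₁ = 0` (`gatedSliceMixLaw_zero`), typed as a `Prop` so that `MixLawCellA5` follows from it (`…QuantGatedSliceMixLawA5Assembly`)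

builds on p205010 (kernel theorem, internal audit signed; external expert review pending)

Statement file (`--supports stmt-CriticalPhenomena-4575`), QUANT lane lead seat prim-quant-lead (gen 33), rung R8 of
`run/shared/lean/prim/quant/LADDER.md`.  Lead g33 NOTES §A5.  One definition (`@[conjecture]` Prop), no theorems.

THE RESIDUAL SUB-CELL `MixLawCellA5r` (a Q-ALONE statement: the moved law `P = zδ₀ + m₁δ_{k₁} + m₁′δ_ℓ + m₂δ_{k₂} + m₂′δ_{k₂+a}`,
`ℓ = k₁ + a`, `t = S + ag(1−z)`, is DEC by itself; the weak-mid law plays no role).  Frame of cell A5 without `h`, and: `1 ≤ k₁`; `k₂`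
compatible with `k₁` (`t < k₁ + k₂`); NOT both lows fit (`m₂ < usage(ℓ,k₂)m₁′ + usage(k₁,k₂)m₁`); the pair `(k₁,k₂)` HEAVY
(`y(k₂ − k₁) ≤ t − 2k₁`) with `k₁ < ag(1−z)`; the shifted low `ℓ` LIGHT at `k₂` (`t − 2ℓ < y(k₂ − ℓ)`); and the bracket
`2k₁(k₂ − S) > t(t − S − k₁)`.  EVIDENCE (lead g33 exact census, explore/a5fstar.py, a5iip.py, a5Estar.py): the whole heavy-and-small-`k₁`
sub-cell (ii′) has 200 000 / 0 non-DEC instances (a ≤ 30, M ≤ 75, all floors incl. TA-tight and threshold-tight), every one certified by the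
filling routing of `decAtT_movedTwoPoint_of_fill`; its offer inequality (OFF) is equivalent (heavy closed form, mean identity) to
  `k₁(t−2k₁)m₁ + t(k₂+k₁−t)·usage(ℓ,k₂)·m₁′ ≤ (t−ℓ)(t−2k₁)m₁′ + k₁(2k₂−t)m₂ + (t−2k₁)(t/y − k₂ − a)m₂′`,
and the load bound (LB) `t(k₂+k₁−t)·usage(ℓ,k₂) ≤ (t−ℓ)(t−2k₁)` holds in ALL of (ii′) (203 588 / 0, worst ratio 0.993) — kernel for
`ℓ` heavy and for the small bracket (`…A5Fill`); in THIS residual (`ℓ` light, big bracket; ≈ 32 % of (ii′), ≈ 2 % of cell A5) (LB) needs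
the unsaturation bound `pairGate(ℓ,k₂) ≤ m₂/(m₁′ + m₂)` together with the three floor bounds `y ≤ min(ρ(k₁,k₂), S/M, (1−z)g)` (each alone
fails; the pure inequality with `usage(ℓ,k₂)(k₂−S) ≤ t−ℓ` substituted holds on the broad region, 167 000 / 0, and is an identity at
`g = 1`, `z = 0`, `y = ρ(k₁,k₂)`).  OWNER: lead g33 (next: the two-regime real-algebra lemma), arm-1 welcome (Q-alone seam).
HONEST STATUS: `MixLawCellA5r` OPEN (evidence only); with it `MixLawCellA5` is a theorem; `GatedSliceMixLaw'`, CW, `GateMove`,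
`SingleGateConvClosed`, `TreeDEC`, `FarTreeRow` OPEN; RATE class log* / honest sentence unchanged.

[this work]; cell map: typer g30 (A5), lead g33 (sub-cells).  The gluing rows served [cite: KozmaNitzan2024, Conjecture 3 (p. 15)]; product
measure [cite: Grimmett1999, §1.3 p. 10].
-/

noncomputable section

namespace Summit.CriticalPhenomena.PercolationContinuityZ3.Theorems

namespace Quant

open Finset

/-- the two-point law `{lo, hi; g}` (as in `…QuantLawDEC`) -/
local notation3 "TP[" lo ", " hi ", " g ", " h "]" =>
  (g : ℝ) * (if (h : ℕ) = (hi : ℕ) then (1 : ℝ) else 0) + (1 - (g : ℝ)) * (if (h : ℕ) = (lo : ℕ) then (1 : ℝ) else 0)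

namespace LawDec

/-- **CELL A5r — the residual Q-alone corner of the mixture cell `MixLawCellA5`** (lead g33): frame of cell A5 without the weak-mid
atom; `1 ≤ k₁`; `t < k₁ + k₂`; not both lows fit into `k₂`; the pair `(k₁, k₂)` heavy with `k₁ < ag(1−z)`; the shifted low `k₁ + a`
light at `k₂`; `2k₁(k₂ − S) > t(t − S − k₁)`.  Conclusion: the moved law is DEC at `(y, t, j)` on `{0..M+a}`.  Evidence and the exact
reduced inequality: file header. [this work] [status: open] -/
@[conjecture] def MixLawCellA5r : Prop :=
  ∀ (y z g S lam : ℝ) (a j M k₁ k₂ : ℕ),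
    0 < y → y < 1 → 0 ≤ z → z < 1 → g ≤ 1 → y ≤ (1 - z) * g → 1 ≤ a → j < M + a → 0 < S → y * (M : ℝ) ≤ S →
    S < (j : ℝ) → S < (M : ℝ) → k₁ ≤ k₂ → k₂ ≤ M → 0 ≤ lam → lam ≤ 1 → (1 - z) * ((k₁ : ℝ) + ((k₂ : ℝ) - k₁) * lam) = S →
    1 ≤ k₁ → 2 * ((k₁ + a : ℕ) : ℝ) < S + (a : ℝ) * g * (1 - z) → k₁ + a ≤ j →
    k₂ ≤ j → S + (a : ℝ) * g * (1 - z) ≤ 2 * (k₂ : ℝ) → S + (a : ℝ) * g * (1 - z) < ((k₁ + a : ℕ) : ℝ) + k₂ → j + 1 ≤ k₂ + a →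
    usage y (S + (a : ℝ) * g * (1 - z)) j (k₁ + a) k₂ * ((1 - z) * (1 - lam) * g) ≤ (1 - z) * lam * (1 - g) →
    (1 - z) * lam * (1 - g) < usage y (S + (a : ℝ) * g * (1 - z)) j (k₁ + a) k₂ * ((1 - z) * (1 - lam) * g)
      + usage y (S + (a : ℝ) * g * (1 - z)) j k₁ k₂ * ((1 - z) * (1 - lam) * (1 - g)) →
    S + (a : ℝ) * g * (1 - z) < (k₁ : ℝ) + k₂ →
    y * ((k₂ : ℝ) - k₁) ≤ S + (a : ℝ) * g * (1 - z) - 2 * (k₁ : ℝ) → (k₁ : ℝ) < (a : ℝ) * g * (1 - z) →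
    S + (a : ℝ) * g * (1 - z) - 2 * ((k₁ + a : ℕ) : ℝ) < y * ((k₂ : ℝ) - ((k₁ + a : ℕ) : ℝ)) →
    (S + (a : ℝ) * g * (1 - z)) * (S + (a : ℝ) * g * (1 - z) - S - (k₁ : ℝ)) < 2 * (k₁ : ℝ) * ((k₂ : ℝ) - S) →
    DECAtT y (S + (a : ℝ) * g * (1 - z)) j (M + a)
      (fun p => z * (if p = 0 then (1 : ℝ) else 0) + (1 - z) * slice (fun q => TP[k₁, k₂, lam, q]) a g p)

end LawDec

end Quant

end Summit.CriticalPhenomena.PercolationContinuityZ3.Theorems
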